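import Summits.Ventures.PercRepro.C041ZoneSplitTransfer

/-!
# The zone split: the projection, its injectivity, and the gluing (p6, gen 26; C-041.md §11 (e))

Setting of `C041ZoneSplitTransfer`.  The OUTSIDE edges are the edges of no indexed zone (`OutEdge`); a cube state
projects to its zone-states and its outside part (`split : CubeT → (∀ Z, ZoneState Z) × OutT`, where `OutT` is the
type of outside parts realised by cube states).  Proved here:

* two indexed zones sharing an edge coincide (`zoneIdx_eq_of_zoneEdge`), so the projection is injective
  (`split_injective`);
* **the gluing** (`glueZones`): zone-states `x Z ∈ 𝓡_Z ∪ 𝓤_Z` (admissible) together with a realised outside part `t` glueZones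
  to a cube state whose projection is `(x, t)` (`isCubeState_glueZones`, `split_glueZones`) — (F2), admissibility is per
  sub-zone: inside an indexed zone the glued configuration agrees with the extension of `x Z`, inside any other zone
  with the cube state realising `t`.

`C041ZoneSplitMain` feeds these into `C041ZoneReductionSplit`.
-/

namespace PercRepro

namespace MultiGraph

open Finset

variable {V E : Type*} {G : MultiGraph V E}

section Glue

variable [Fintype V] (G) (a b c : V) (O : Config E)

/-- An outside edge: an edge of no indexed zone. -/
def OutEdge (e : E) : Prop := ¬ ∃ Z : G.ZoneIdx a b c O, G.ZoneEdge a b Z.1 e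

/-- An outside state: a colouring of the outside edges. -/
abbrev OutState := {e : E // G.OutEdge a b c O e} → Bool

/-- The restriction of a configuration to the outside edges. -/
def restrictOut (S : Config E) : G.OutState a b c O := fun e => S e.1

/-- The outside parts realised by cube states. -/
abbrev OutT := {t : G.OutState a b c O // ∃ S, G.IsCubeState a b c O S ∧ G.restrictOut a b c O S = t}

/-- The cube states of `O`, as a type. -/
abbrev CubeT := {S : Config E // G.IsCubeState a b c O S}

/-- The zone projection of a cube state. -/
def split (S : G.CubeT a b c O) : (∀ Z : G.ZoneIdx a b c O, G.ZoneState a b Z.1) × G.OutT a b c O :=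
  (fun Z => G.restrictZone a b Z.1 S.1, ⟨G.restrictOut a b c O S.1, S.1, S.2, rfl⟩)

open Classical in
/-- The gluing of zone-states and an outside state. -/
noncomputable def glueZones (x : ∀ Z : G.ZoneIdx a b c O, G.ZoneState a b Z.1) (t : G.OutState a b c O) :
    Config E := fun e =>
  if h : ∃ Z : G.ZoneIdx a b c O, G.ZoneEdge a b Z.1 e then
    x (Classical.choose h) ⟨e, Classical.choose_spec h⟩
  else t ⟨e, h⟩

variable {G a b c O}

/-- Two zones sharing a vertex coincide. -/
theorem zone_eq_of_mem_mem {z z' v : V} (hv : v ∈ G.zone a b O z) (hv' : v ∈ G.zone a b O z') :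
    G.zone a b O z = G.zone a b O z' :=
  (zone_eq_of_mem a b O hv).symm.trans (zone_eq_of_mem a b O hv')

omit [Fintype V] in
/-- Two zones of non-terminals sharing an edge share a vertex. -/
theorem exists_mem_mem_of_zoneEdge {Z Z' : Finset V} (hZ : ∀ v ∈ Z, v ≠ a ∧ v ≠ b)
    {e : E} (he : G.ZoneEdge a b Z e) (he' : G.ZoneEdge a b Z' e) :
    ∃ v, v ∈ Z ∧ v ∈ Z' := by
  rcases he with ⟨hb, h1, _⟩ | ⟨v, hv, hj⟩ <;> rcases he' with ⟨hb', h1', _⟩ | ⟨v', hv', hj'⟩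
  · exact ⟨G.fst e, h1, h1'⟩
  · exfalso
    rcases hj' with hj' | hj'
    · exact hb.1 (EdgeAt.of_joins_right hj')
    · exact hb.2 (EdgeAt.of_joins_right hj')
  · exfalso
    rcases hj with hj | hj
    · exact hb'.1 (EdgeAt.of_joins_right hj)
    · exact hb'.2 (EdgeAt.of_joins_right hj)
  · refine ⟨v, hv, ?_⟩
    have hue : G.EdgeAt e v := by
      rcases hj with hj | hj <;> exact EdgeAt.of_joins_left hj
    have : v = v' := by
      rcases hj' with hj' | hj'
      · exact eq_of_joins_terminal hj' (hZ v hv) (Or.inl rfl) hue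
      · exact eq_of_joins_terminal hj' (hZ v hv) (Or.inr rfl) hue
    exact this ▸ hv'

/-- **Two indexed zones sharing an edge coincide.** -/
theorem zoneIdx_eq_of_zoneEdge (hc : c ≠ a ∧ c ≠ b) {Z Z' : Finset V} (hZ : G.IsIdxZone a b c O Z)
    (hZ' : G.IsIdxZone a b c O Z') {e : E} (he : G.ZoneEdge a b Z e) (he' : G.ZoneEdge a b Z' e) : Z = Z' := by
  obtain ⟨v, hv, hv'⟩ := exists_mem_mem_of_zoneEdge (fun v hv => ne_terminal_of_mem_idxZone hc hZ hv) he he'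
  obtain ⟨z, hz⟩ := hZ.1
  obtain ⟨z', hz'⟩ := hZ'.1
  subst hz hz'
  exact zone_eq_of_mem_mem hv hv'

/-- The gluing on an edge of the indexed zone `Z`. -/
theorem glueZones_of_zoneEdge (hc : c ≠ a ∧ c ≠ b) (x : ∀ Z : G.ZoneIdx a b c O, G.ZoneState a b Z.1)
    (t : G.OutState a b c O) (Z : G.ZoneIdx a b c O) {e : E} (he : G.ZoneEdge a b Z.1 e) :
    G.glueZones a b c O x t e = x Z ⟨e, he⟩ := by
  classical
  have h : ∃ Z : G.ZoneIdx a b c O, G.ZoneEdge a b Z.1 e := ⟨Z, he⟩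
  unfold glueZones
  rw [dif_pos h]
  have hZ : Classical.choose h = Z := by
    apply Subtype.ext
    exact zoneIdx_eq_of_zoneEdge hc (Classical.choose h).2 Z.2 (Classical.choose_spec h) he
  subst hZ
  rfl

/-- The gluing on an outside edge. -/
theorem glueZones_of_outEdge (x : ∀ Z : G.ZoneIdx a b c O, G.ZoneState a b Z.1) (t : G.OutState a b c O) {e : E}
    (he : G.OutEdge a b c O e) : G.glueZones a b c O x t e = t ⟨e, he⟩ := by
  unfold glueZones
  rw [dif_neg he]

/-- **The zone projection is injective.** -/
theorem split_injective : Function.Injective (G.split a b c O) := by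
  intro S S' h
  have h1 := congrArg Prod.fst h
  have h2 := congrArg (fun p => (Prod.snd p).1) h
  apply Subtype.ext
  funext e
  by_cases he : ∃ Z : G.ZoneIdx a b c O, G.ZoneEdge a b Z.1 e
  · obtain ⟨Z, hZ⟩ := he
    exact congrFun (congrFun h1 Z) ⟨e, hZ⟩
  · exact congrFun h2 ⟨e, he⟩

/-- The restriction of a gluing to an indexed zone is the given zone-state. -/
theorem restrictZone_glueZones (hc : c ≠ a ∧ c ≠ b) (x : ∀ Z : G.ZoneIdx a b c O, G.ZoneState a b Z.1)
    (t : G.OutState a b c O) (Z : G.ZoneIdx a b c O) :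
    G.restrictZone a b Z.1 (G.glueZones a b c O x t) = x Z := by
  funext ⟨e, he⟩
  exact glueZones_of_zoneEdge hc x t Z he

/-- The outside restriction of a gluing is the given outside state. -/
theorem restrictOut_glueZones (x : ∀ Z : G.ZoneIdx a b c O, G.ZoneState a b Z.1) (t : G.OutState a b c O) :
    G.restrictOut a b c O (G.glueZones a b c O x t) = t := by
  funext ⟨e, he⟩
  exact glueZones_of_outEdge x t he

/-- The gluing agrees with the extension of `x Z` on the edges of the indexed zone `Z`. -/
theorem glueZones_agree_extZone (hc : c ≠ a ∧ c ≠ b) (x : ∀ Z : G.ZoneIdx a b c O, G.ZoneState a b Z.1)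
    (t : G.OutState a b c O) (Z : G.ZoneIdx a b c O) :
    ∀ e, G.ZoneEdge a b Z.1 e → G.extZone a b O Z.1 (x Z) e = G.glueZones a b c O x t e := by
  intro e he
  rw [glueZones_of_zoneEdge hc x t Z he, extZone_of_zoneEdge _ he]

/-- Every edge of a non-indexed zone of a non-terminal is an outside edge. -/
theorem outEdge_of_not_idx {z : V} (hz : z ≠ a ∧ z ≠ b)
    (hnot : ¬ G.IsIdxZone a b c O (G.zone a b O z)) {e : E} (he : G.ZoneEdge a b (G.zone a b O z) e) :
    G.OutEdge a b c O e := by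
  rintro ⟨Z, hZe⟩
  apply hnot
  obtain ⟨v, hv, hv'⟩ := exists_mem_mem_of_zoneEdge (fun v hv => ne_terminal_of_mem_zone hz hv) he hZe
  obtain ⟨z', hz'⟩ := Z.2.1
  have : G.zone a b O z = Z.1 := by
    rw [hz'] at hv' ⊢
    exact zone_eq_of_mem_mem hv hv'
  rw [this]
  exact Z.2

/-- The gluing agrees with a cube state realising `t` on the edges of a non-indexed zone of a non-terminal. -/
theorem glueZones_agree_out {z : V} (hz : z ≠ a ∧ z ≠ b) (hnot : ¬ G.IsIdxZone a b c O (G.zone a b O z))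
    (x : ∀ Z : G.ZoneIdx a b c O, G.ZoneState a b Z.1) {t : G.OutState a b c O} {S₀ : Config E}
    (hS₀t : G.restrictOut a b c O S₀ = t) :
    ∀ e, G.ZoneEdge a b (G.zone a b O z) e → S₀ e = G.glueZones a b c O x t e := by
  intro e he
  rw [glueZones_of_outEdge x t (outEdge_of_not_idx hz hnot he), ← hS₀t]
  rfl

/-- The per-edge cube conditions of a gluing of admissible zone-states and a realised outside part. -/
theorem glueZones_edge_conds (hc : c ≠ a ∧ c ≠ b) (x : ∀ Z : G.ZoneIdx a b c O, G.ZoneState a b Z.1)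
    (hx : ∀ Z, G.AdmZone a b c O Z.1 (x Z)) {t : G.OutState a b c O} {S₀ : Config E}
    (hS₀ : G.IsCubeState a b c O S₀) (hS₀t : G.restrictOut a b c O S₀ = t) :
    (∀ e, G.Bare a b e → O e = true → G.glueZones a b c O x t e = true) ∧
      ∀ e, G.Bare a b e → O e = false → G.glueZones a b c O x t e = true → G.InteriorBlue a b O e := by
  constructor
  · intro e he hO
    by_cases hZ : ∃ Z : G.ZoneIdx a b c O, G.ZoneEdge a b Z.1 e
    · obtain ⟨Z, hZe⟩ := hZ
      rw [glueZones_of_zoneEdge hc x t Z hZe]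
      exact (hx Z).1 e hZe he hO
    · rw [glueZones_of_outEdge x t hZ, ← hS₀t]
      exact hS₀.1 e he hO
  · intro e he hO hSe
    by_cases hZ : ∃ Z : G.ZoneIdx a b c O, G.ZoneEdge a b Z.1 e
    · obtain ⟨Z, hZe⟩ := hZ
      rw [glueZones_of_zoneEdge hc x t Z hZe] at hSe
      exact (hx Z).2.1 e hZe he hO hSe
    · rw [glueZones_of_outEdge x t hZ, ← hS₀t] at hSe
      exact hS₀.2.1 e he hO hSe

/-- **The gluing of admissible zone-states and a realised outside part is a cube state** — (F2), admissibility is per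
sub-zone: inside an indexed zone the gluing agrees with the extension of the zone-state, inside any other zone with the
realising cube state. -/
theorem isCubeState_glueZones (hc : c ≠ a ∧ c ≠ b) (hne : a ≠ b) (x : ∀ Z : G.ZoneIdx a b c O, G.ZoneState a b Z.1)
    (hx : ∀ Z, G.AdmZone a b c O Z.1 (x Z)) (t : G.OutT a b c O) :
    G.IsCubeState a b c O (G.glueZones a b c O x t.1) := by
  obtain ⟨t, S₀, hS₀, hS₀t⟩ := t
  have hedge := glueZones_edge_conds hc x hx hS₀ hS₀t
  have hsub : G.BlueSub a b O (G.glueZones a b c O x t) := blueSub_of_cube hedge.1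
  have hadm₀ := (adm_iff a b c hc hne).1 hS₀.2.2
  refine ⟨hedge.1, hedge.2, ?_⟩
  rw [adm_iff a b c hc hne]
  refine ⟨fun e he => ?_, fun v hva hvb hatt => ?_, ?_⟩
  · have hout : G.OutEdge a b c O e := fun ⟨Z, hZe⟩ => not_zoneEdge_of_joins_terminals hc Z.2 he hZe
    rw [glueZones_of_outEdge x t hout, ← hS₀t]
    show S₀ e = true
    by_contra h
    have hSe : S₀ e = false := by
      cases h' : S₀ e
      · rfl
      · exact absurd h' h
    exact hS₀.2.2.2.2 (Conn.of_openAdj ⟨e, compl_eq_true_of_eq_false hSe, he⟩)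
  · by_cases hidx : G.IsIdxZone a b c O (G.zone a b O v)
    · have hagree := glueZones_agree_extZone hc x t ⟨_, hidx⟩
      rw [attached_iff_of_agree hsub (blueSub_extZone (hx ⟨_, hidx⟩)) hagree (self_mem_zone a b O v) (Or.inl rfl),
        attached_iff_of_agree hsub (blueSub_extZone (hx ⟨_, hidx⟩)) hagree (self_mem_zone a b O v)
          (Or.inr rfl)] at hatt
      exact (hx ⟨_, hidx⟩).2.2.1 v (self_mem_zone a b O v) hatt
    · have hagree := glueZones_agree_out ⟨hva, hvb⟩ hidx x hS₀t
      rw [attached_iff_of_agree hsub (blueSub_of_cube hS₀.1) hagree (self_mem_zone a b O v) (Or.inl rfl),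
        attached_iff_of_agree hsub (blueSub_of_cube hS₀.1) hagree (self_mem_zone a b O v) (Or.inr rfl)] at hatt
      exact hadm₀.2.1 v hva hvb hatt
  · by_cases hidx : G.IsIdxZone a b c O (G.zone a b O c)
    · have hagree := glueZones_agree_extZone hc x t ⟨_, hidx⟩
      rw [attached_iff_of_agree hsub (blueSub_extZone (hx ⟨_, hidx⟩)) hagree (self_mem_zone a b O c) (Or.inl rfl),
        attached_iff_of_agree hsub (blueSub_extZone (hx ⟨_, hidx⟩)) hagree (self_mem_zone a b O c) (Or.inr rfl)]
      exact (hx ⟨_, hidx⟩).2.2.2 (self_mem_zone a b O c)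
    · have hagree := glueZones_agree_out hc hidx x hS₀t
      rw [attached_iff_of_agree hsub (blueSub_of_cube hS₀.1) hagree (self_mem_zone a b O c) (Or.inl rfl),
        attached_iff_of_agree hsub (blueSub_of_cube hS₀.1) hagree (self_mem_zone a b O c) (Or.inr rfl)]
      exact hadm₀.2.2

/-- **The projection of the gluing is the given pair**: the zone projection is onto the admissible tuples with a
realised outside part. -/
theorem split_glueZones (hc : c ≠ a ∧ c ≠ b) (hne : a ≠ b) (x : ∀ Z : G.ZoneIdx a b c O, G.ZoneState a b Z.1)
    (hx : ∀ Z, G.AdmZone a b c O Z.1 (x Z)) (t : G.OutT a b c O) :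
    G.split a b c O ⟨G.glueZones a b c O x t.1, isCubeState_glueZones hc hne x hx t⟩ = (x, t) := by
  refine Prod.ext ?_ ?_
  · funext Z
    exact restrictZone_glueZones hc x t.1 Z
  · exact Subtype.ext (restrictOut_glueZones x t.1)

end Glue

end MultiGraph

end PercRepro
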